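import Summits.BirchSwinnertonDyer.Rank1Residual.Additive.StabilisedDualSideAlgebra
import HarnessLib

/-!
# The stabilised dual side of the count (C) in SELMER SHAPE: `[R : R ∩ loc_p⁻¹([p^t]⁻¹ D) ∩ ⋂ loc_ℓ⁻¹ D_ℓ]
# = p^{n−ν}` for the relaxed-at-`p` Selmer group `R`, from the relaxed/strict count at `p`, the
# `Ш`-exponent and the orders of `κ(P)` and `loc_p κ(P)` (cell `b2b-bsdres`, CLASS-CLOSURE lane,
# class O10 — x1b GEN 37, class lead; file 61 of the series: brick B6 of the global count (C) at
# FINITE level, subgroup form — the shape in which the Kummer Selmer structure instantiates it)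

HONEST FRAMING (cell `b2b-bsdres`, run/shared/lean/b2b/bsd-rank1-residual/, verbatim in every
file): the goal of the cell is to DELETE the COMBINATION-SHAPED residual classes of the
Birch–Swinnerton-Dyer formula for ALL analytic-rank `≤ 1` elliptic curves over `ℚ` — "full BSD
formula for every rank `≤ 1` curve in class `C`" assembled STRICTLY from published theorems — so
that the rank-`≤ 1` remainder becomes exactly the CONSTRUCTION-SHAPED classes, which are TYPED
(missing-input `Prop`s), NOT attempted. This is not "finishing BSD". CLASS-CLOSURE lane: prove
what is provable now; shrink each hard class to its core with data; no claim beyond stated classes;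
research routes on CONSTRUCTION-SHAPED X12 / O10; census / instrument output = EVIDENCE / conjecture
items, NEVER a Literature fact; `RESIDUAL-MAP.md` marks change only by signed lines. THIS FILE:
TOOL THEOREMS ONLY (abelian-group bookkeeping) — no definition, no named Literature fact, no
Summits-side fact `def … : Prop`, no `sorry`, axioms standard; nothing is booked; no label / mark /
count / sub-cell moves; (C1_η), (C2_η-GZ), (C3_η) stay typed as filed (cc-typer-6's pen); O10 stays
OPEN / CONSTRUCTION-SHAPED; nothing about `BSD(W, p)` of any pair is claimed.

## What

File 60 (`StabilisedDual`) computes `[R : ker(p^t·φ) ⊓ ⨅ ψ_i⁻¹ D_i] = p^{m−t−ν}` for an abstract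
group `R` of exponent `p^m` with a cyclic subgroup `ℤg` of order `p^m` absorbing `p^k R`.  In the
count (C) the group is a SUBGROUP `R ≤ H = H¹(ℚ, W[p^m])` — the Selmer group of the Kummer structure
RELAXED at `p` — cut out, together with its relatives, by localisation maps: `S = R ⊓ loc_p⁻¹(L)`
(`L` the local Kummer condition at `p`; `S = Sel^{(p^m)}(W/ℚ)`), `S₀ = R ⊓ ker loc_p` (strict at `p`),
and the dual Selmer group `R ⊓ loc_p⁻¹([p^t]⁻¹ D) ⊓ ⨅_ℓ loc_ℓ⁻¹(D_ℓ)` (`D = w⁻¹(C_m^*)` the Weil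
transport of the annihilator of the signed condition, `D_ℓ = w⁻¹(𝒦_{m,ℓ}^*)`).  THIS FILE restates
file 60 in that shape and derives its input `p^k R ⊆ ℤg` from Selmer-shaped data:

* §1 `relIndex_inf_ker_eq_mul` — `[R : S₀] = [R : S] · #loc_p(S)`; `relIndex_inf_comap_dvd` — if
  `[R : S₀] = p^m` (the relaxed/strict count at `p`: X5 `relIndex_kummer_update_bot_update_top_eq`,
  `= #E(ℚ_p)[p^m] · #(ℤ_p/p^m) = p^m`) and some `g ∈ S` has `ord(loc_p g) = p^{m−ν}`, then
  **`[R : S] ∣ p^ν`**; `nsmul_mem_inf_comap` — hence `p^ν R ⊆ S`; `pow_nsmul_mem_zmultiples` — with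
  `p^e S ⊆ ℤg` (`p^e Ш(W)[p^∞] = 0` and `S/ℤg ≅ Ш[p^m]`): **`p^{ν+e} R ⊆ ℤg`**.
* §2 **`relIndex_dualSide_eq_prime_pow`** — for `R ≤ H` with `p^m R = 0`, `g ∈ R` of order `p^m` with
  `loc_p g ∈ L`, `ord(loc_p g) = p^{m−ν}`, `L ⊓ D = ⊥` (the Kummer line is TRANSVERSE to `D`),
  `[R : S₀] = p^m`, `p^e S ⊆ ℤg`, `ν + e ≤ t`, `t + ν ≤ m`, and local conditions `D_ℓ` holding on `R[p^t]`
  and at `p^{m−t−ν} g`: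
  **`[R : R ⊓ loc_p⁻¹([p^t]⁻¹ D) ⊓ ⨅_ℓ loc_ℓ⁻¹(D_ℓ)] = p^{m−t−ν}`** (`= p^{n−ν}`, `n = m − t`) — file 60's
  `index_eq_prime_pow` on `↥R` with `φ = (mod D) ∘ loc_p`, the order of `φ g` by
  `addOrderOf_mk_eq_of_inf_eq_bot`; `relIndex_inf_comap_nsmul_eq_prime_pow` — the same without the `D_ℓ`.

NOT here: that these subgroups ARE the (transported) dual Selmer groups `H¹_{𝓕^*}`, `H¹_{𝓖^*}` of the
Poitou–Tate pair of (C) (X5 `dualSelmerGroup_eq_map_selmerGroup_dualTransported`, Kummer self-duality);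
the arithmetic discharges (`ord κ_m(P) = p^m`, `#loc`, the level-`t` argument for `R[p^t]`); B3.

References: [GreenbergLNM1716] §4 (proof of Thm. 4.1, pp. 98–103); [MilneADT2006] I §6 (6.14),
Lemma 6.15; [Kobayashi2003] Thm. 9.3 (p. 26).
-/

namespace Summit.BirchSwinnertonDyer.Rank1Residual.Additive

namespace StabilisedDual

open AddSubgroup

/-! ## §1 `[R : S] ∣ p^ν` from the relaxed/strict count and one Selmer class; `p^{ν+e} R ⊆ ℤg` -/

section RelaxedStrict

variable {H Hp : Type*} [AddCommGroup H] [AddCommGroup Hp] (loc : H →+ Hp) (L : AddSubgroup Hp)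
  (R : AddSubgroup H)

/-- **`[R : S₀] = [R : S] · #loc(S)`** for `S = R ⊓ loc⁻¹(L)`, `S₀ = R ⊓ ker loc` (`S₀ ≤ S ≤ R`;
`S/S₀ ≅ loc(S)`).  In (C): `R` relaxed at `p`, `S = Sel^{(p^m)}`, `S₀` strict at `p`. [folklore] -/
theorem relIndex_inf_ker_eq_mul :
    (R ⊓ loc.ker).relIndex R =
      (R ⊓ L.comap loc).relIndex R * Nat.card ((R ⊓ L.comap loc).map loc) := by
  have hS0S : R ⊓ loc.ker ≤ R ⊓ L.comap loc := fun x hx => by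
    have hx' := AddSubgroup.mem_inf.mp hx
    refine AddSubgroup.mem_inf.mpr ⟨hx'.1, AddSubgroup.mem_comap.mpr ?_⟩
    rw [(AddMonoidHom.mem_ker).mp hx'.2]
    exact zero_mem _
  have hSR : R ⊓ L.comap loc ≤ R := inf_le_left
  rw [← AddSubgroup.relIndex_mul_relIndex (R ⊓ loc.ker) (R ⊓ L.comap loc) R hS0S hSR, mul_comm]
  congr 1
  -- `[S : S₀] = #loc(S)`
  have h1 : (R ⊓ loc.ker).relIndex (R ⊓ L.comap loc) = loc.ker.relIndex (R ⊓ L.comap loc) := by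
    have : R ⊓ loc.ker ⊓ (R ⊓ L.comap loc) = loc.ker ⊓ (R ⊓ L.comap loc) := by
      ext x; simp only [AddSubgroup.mem_inf]; tauto
    rw [← AddSubgroup.inf_relIndex_right (R ⊓ loc.ker), this, AddSubgroup.inf_relIndex_right]
  rw [h1, AddSubgroup.relIndex_ker]

/-- **`[R : S] ∣ c₀`** whenever `[R : S₀] = ord(loc g) · c₀` for some `g ∈ S = R ⊓ loc⁻¹(L)` with
`ord(loc g) ≠ 0`: `[R : S] · #loc(S) = [R : S₀]` and `ord(loc g) ∣ #loc(S)` (Lagrange).  In (C):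
`[R : S₀] = p^m` (the relaxed/strict count at `p`: `#E(ℚ_p)[p^m] · #(ℤ_p/p^m)` with `E(ℚ_p)[p] = 0`),
`g = κ_m(P)` with `ord(loc_p κ_m(P)) = p^{m−ν}`, `c₀ = p^ν`. [cite: MilneADT2006, Ch. I, Lemma 6.15] -/
theorem relIndex_inf_comap_dvd {c₀ : ℕ} {g : H} (hgR : g ∈ R) (hgL : loc g ∈ L)
    (hord : addOrderOf (loc g) ≠ 0)
    (hcount : (R ⊓ loc.ker).relIndex R = addOrderOf (loc g) * c₀) :
    (R ⊓ L.comap loc).relIndex R ∣ c₀ := by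
  have hmul := relIndex_inf_ker_eq_mul loc L R
  rw [hcount] at hmul
  -- `ord(loc g) ∣ #loc(S)`
  have hgS : loc g ∈ (R ⊓ L.comap loc).map loc :=
    ⟨g, AddSubgroup.mem_inf.mpr ⟨hgR, AddSubgroup.mem_comap.mpr hgL⟩, rfl⟩
  have hdvd : addOrderOf (loc g) ∣ Nat.card ((R ⊓ L.comap loc).map loc) := by
    rw [← AddSubgroup.addOrderOf_mk (loc g) hgS]
    exact addOrderOf_dvd_natCard _
  obtain ⟨c, hc⟩ := hdvd
  refine ⟨c, ?_⟩
  rw [hc, mul_left_comm] at hmul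
  exact Nat.eq_of_mul_eq_mul_left (Nat.pos_of_ne_zero hord) hmul

/-- **`p^ν R ⊆ S`**, prime-power form: `[R : S₀] = p^m`, `g ∈ S` with `ord(loc g) = p^{m−ν}`, `ν ≤ m`
⟹ `[R : S] ∣ p^ν` and `p^ν • x ∈ S` for every `x ∈ R`. [cite: MilneADT2006, Ch. I, Lemma 6.15] -/
theorem nsmul_mem_inf_comap {p m ν : ℕ} (hp : p.Prime)
    (hcount : (R ⊓ loc.ker).relIndex R = p ^ m)
    {g : H} (hgR : g ∈ R) (hgL : loc g ∈ L) (hord : addOrderOf (loc g) = p ^ (m - ν))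
    (hνm : ν ≤ m) {x : H} (hx : x ∈ R) : p ^ ν • x ∈ R ⊓ L.comap loc := by
  have hdvd : (R ⊓ L.comap loc).relIndex R ∣ p ^ ν := by
    refine relIndex_inf_comap_dvd loc L R hgR hgL (by rw [hord]; exact pow_ne_zero _ hp.ne_zero) ?_
    rw [hcount, hord, ← pow_add]
    congr 1
    omega
  obtain ⟨c, hc⟩ := hdvd
  rw [hc, mul_comm, mul_nsmul']
  exact AddSubgroup.nsmul_mem _ ((R ⊓ L.comap loc).nsmul_relIndex_mem hx) c

/-- **`p^{ν+e} R ⊆ ℤg`**: with moreover `p^e S ⊆ ℤg` (`S/ℤκ_m(P) ≅ Ш(W)[p^m]`, `p^e Ш(W)[p^∞] = 0`),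
every `x ∈ R` has `p^{ν+e} • x ∈ ℤg` — the hypothesis `hk` of file 60. [cite: MilneADT2006, Ch. I §6, (6.14)] -/
theorem pow_nsmul_mem_zmultiples {p m ν e : ℕ} (hp : p.Prime)
    (hcount : (R ⊓ loc.ker).relIndex R = p ^ m)
    {g : H} (hgR : g ∈ R) (hgL : loc g ∈ L) (hord : addOrderOf (loc g) = p ^ (m - ν))
    (hνm : ν ≤ m) (hSha : ∀ s ∈ R ⊓ L.comap loc, p ^ e • s ∈ zmultiples g) {x : H} (hx : x ∈ R) :
    p ^ (ν + e) • x ∈ zmultiples g := by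
  rw [pow_add, mul_comm, mul_nsmul']
  exact hSha _ (nsmul_mem_inf_comap loc L R hp hcount hgR hgL hord hνm hx)

end RelaxedStrict

/-! ## §2 The stabilised dual-side index in Selmer shape -/

section DualSide

variable {H Hp : Type*} [AddCommGroup H] [AddCommGroup Hp] (loc : H →+ Hp) (L D : AddSubgroup Hp)
  (R : AddSubgroup H) {ι : Type*} {Hl : ι → Type*} [∀ i, AddCommGroup (Hl i)]
  (locl : ∀ i, H →+ Hl i) (Dl : ∀ i, AddSubgroup (Hl i))

/-- **B6 at finite level, Selmer shape.** `R ≤ H` with `p^m R = 0`; `g ∈ R` of order `p^m` with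
`loc g ∈ L`, `ord(loc g) = p^{m−ν}` (`ν ≤ m`); `L ⊓ D = ⊥`; `[R : R ⊓ ker loc] = p^m`; `p^e • S ⊆ ℤg` for
`S = R ⊓ loc⁻¹(L)`; `ν + e ≤ t`, `t + ν ≤ m`; every `loc_i` sends `{y ∈ R | p^t y = 0}` and
`p^{m−t−ν} g` into `D_i`.  Then
**`[R : R ⊓ loc⁻¹([p^t]⁻¹ D) ⊓ ⨅_i loc_i⁻¹(D_i)] = p^{m−t−ν}`** (`= p^{n−ν}`, `n = m − t`).  In (C):
`H = H¹(ℚ, W[p^m])`, `R` the Kummer structure relaxed at `p`, `L` the Kummer line at `p`, `g = κ_m(P)`,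
`D = w⁻¹(C_m^*)`, `D_ℓ = w⁻¹(𝒦_{m,ℓ}^*)`; the left side is `[H¹_{𝓕^*} : H¹_{𝓖^*}]` of the Poitou–Tate pair
of the count, after Weil transport. [cite: GreenbergLNM1716, §4 (pp. 98–103)]
[cite: Kobayashi2003, Thm. 9.3 (p. 26)] -/
theorem relIndex_dualSide_eq_prime_pow {p m ν e t : ℕ} (hp : p.Prime)
    (hR : ∀ x ∈ R, p ^ m • x = 0) {g : H} (hgR : g ∈ R) (hgL : loc g ∈ L)
    (hg : addOrderOf g = p ^ m) (hlocg : addOrderOf (loc g) = p ^ (m - ν)) (hνm : ν ≤ m)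
    (hLD : L ⊓ D = ⊥) (hcount : (R ⊓ loc.ker).relIndex R = p ^ m)
    (hSha : ∀ s ∈ R ⊓ L.comap loc, p ^ e • s ∈ zmultiples g) (het : ν + e ≤ t) (htν : t + ν ≤ m)
    (hDt : ∀ i, ∀ y ∈ R, p ^ t • y = 0 → locl i y ∈ Dl i)
    (hDg : ∀ i, locl i (p ^ (m - t - ν) • g) ∈ Dl i) :
    (R ⊓ (D.comap (nsmulAddMonoidHom (p ^ t))).comap loc ⊓ ⨅ i, (Dl i).comap (locl i)).relIndex R =
      p ^ (m - t - ν) := by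
  -- transfer to the subtype `↥R`
  set φ : R →+ Hp ⧸ D := (QuotientAddGroup.mk' D).comp (loc.comp R.subtype) with hφ
  set ψ : ∀ i, R →+ Hl i := fun i => (locl i).comp R.subtype with hψ
  set g' : R := ⟨g, hgR⟩ with hg'
  have hR' : ∀ x : R, p ^ m • x = 0 := fun x =>
    Subtype.ext (by rw [AddSubmonoidClass.coe_nsmul, hR x x.2]; rfl)
  have hg'' : addOrderOf g' = p ^ m := by rw [hg', AddSubgroup.addOrderOf_mk, hg]
  have hk : ∀ x : R, p ^ (ν + e) • x ∈ zmultiples g' := fun x => by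
    obtain ⟨b, hb⟩ := mem_zmultiples_iff.mp
      (pow_nsmul_mem_zmultiples loc L R hp hcount hgR hgL hlocg hνm hSha x.2)
    refine mem_zmultiples_iff.mpr ⟨b, Subtype.ext ?_⟩
    rw [AddSubgroupClass.coe_zsmul, AddSubmonoidClass.coe_nsmul, hb]
  have hφg : addOrderOf (φ g') = p ^ (m - ν) := by
    rw [hφ, AddMonoidHom.comp_apply, AddMonoidHom.comp_apply, R.subtype_apply,
      addOrderOf_mk_eq_of_inf_eq_bot L D hLD hgL, hlocg]
  have hψt : ∀ i, ∀ y : R, p ^ t • y = 0 → ψ i y ∈ Dl i := fun i y hy =>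
    hDt i y y.2 (by rw [← AddSubmonoidClass.coe_nsmul, hy]; rfl)
  have hψg : ∀ i, ψ i (p ^ (m - t - ν) • g') ∈ Dl i := fun i => by
    rw [hψ]
    change locl i ((p ^ (m - t - ν) • g' : R) : H) ∈ Dl i
    rw [AddSubmonoidClass.coe_nsmul]
    exact hDg i
  have hidx := index_eq_prime_pow φ ψ Dl hp hR' hg'' hk het htν hφg hψt hψg
  -- identify the subgroup of `↥R`
  rw [AddSubgroup.relIndex, ← hidx]
  congr 1
  ext x
  simp only [AddSubgroup.mem_addSubgroupOf, AddSubgroup.mem_inf, AddSubgroup.mem_comap,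
    AddSubgroup.mem_iInf, AddMonoidHom.mem_ker, nsmulAddMonoidHom_apply, hφ, hψ,
    AddMonoidHom.nsmul_apply, AddMonoidHom.comp_apply, AddSubgroup.subtype_apply,
    QuotientAddGroup.mk'_apply, ← QuotientAddGroup.mk_nsmul, QuotientAddGroup.eq_zero_iff]
  exact ⟨fun h => ⟨h.1.2, h.2⟩, fun h => ⟨⟨x.2, h.1⟩, h.2⟩⟩

/-- The same WITHOUT further local conditions: **`[R : R ⊓ loc⁻¹([p^t]⁻¹ D)] = p^{m−t−ν}`**.
[cite: GreenbergLNM1716, §4 (pp. 98–103)] -/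
theorem relIndex_inf_comap_nsmul_eq_prime_pow {p m ν e t : ℕ} (hp : p.Prime)
    (hR : ∀ x ∈ R, p ^ m • x = 0) {g : H} (hgR : g ∈ R) (hgL : loc g ∈ L)
    (hg : addOrderOf g = p ^ m) (hlocg : addOrderOf (loc g) = p ^ (m - ν)) (hνm : ν ≤ m)
    (hLD : L ⊓ D = ⊥) (hcount : (R ⊓ loc.ker).relIndex R = p ^ m)
    (hSha : ∀ s ∈ R ⊓ L.comap loc, p ^ e • s ∈ zmultiples g) (het : ν + e ≤ t) (htν : t + ν ≤ m) :
    (R ⊓ (D.comap (nsmulAddMonoidHom (p ^ t))).comap loc).relIndex R = p ^ (m - t - ν) := by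
  have h := relIndex_dualSide_eq_prime_pow loc L D R (ι := Empty) (Hl := fun _ => Unit)
    (fun i => i.elim) (fun i => i.elim) hp hR hgR hgL hg hlocg hνm hLD hcount hSha het htν
    (fun i => i.elim) (fun i => i.elim)
  simpa only [iInf_of_empty, inf_top_eq] using h

end DualSide

end StabilisedDual

end Summit.BirchSwinnertonDyer.Rank1Residual.Additive
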